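import Mathlib
import HarnessLib
import Literature.MathematicalPhysics.StatisticalMechanics.ComplexGradientStiffness
import Summits.HubbardSuperconductivity.HubbardSuperconductivity.Theorems.ComplexGFFStiffnessDefs
import Summits.HubbardSuperconductivity.HubbardSuperconductivity.Theorems.ComplexGFFStiffnessHypACumulantPertZBasic

/-!
# Crux `HypALocalTwoPoint`, line `gnv` — the one-point function is the derivative of the partition
# function along the line `s ↦ K + s·G·(1+K)`, and second differences control first derivatives

Route `route-HubbardSuperconductivity-ComplexGFFStiffness`, crux item stmt-HubbardSuperconductivity-19155,
registered stub `stub_twoPointGivenZ : TwoPointGivenZ`, reduced (`…HypALocalTwoPointReduction`) to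
`…Theorems.ComplexGFF.OnePointLipschitz`.  This file supplies the two FIXED-VOLUME pieces of the proof
of `OnePointLipschitz` (census entries (C1), (C2) of the line memo):

* (C1) `hasDerivAt_pertZ_linePert` — for continuous `K` of Gaussian growth and bounded continuous `G`,
  `s ↦ pertZ n (K + s·G·(1+K))` is differentiable at `s = 0` with derivative
  `∫ (Σ_x G(∇φ(x))) e^{−S_0}∏(1+K) dφ` (`1 + K + sG(1+K) = (1+K)(1+sG)`, dominated differentiation of
  `∏_x (1 + s G(∇φ(x)))`); `hasDerivAt_pertZ_linePert_div` — normalised by `pertZ n K ≠ 0` the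
  derivative is `|Λ| · onePoint n K G` ([ABKM19] (4.4)/(2.9), `ℓ = 1`);
* (C2) `norm_sub_le_of_norm_div_sub_one_le` — if `Φ, Ψ` are differentiable at `0`, `Φ(0) = Ψ(0) = 1`
  and `‖Φ(s)/Ψ(s) − 1‖ ≤ M|s|` near `0`, then `‖Φ'(0) − Ψ'(0)‖ ≤ M`: a bound on MIXED SECOND
  DIFFERENCES of `log pertZ` bounds the difference of one-point functions — no derivative of the
  renormalisation-group maps is ever needed, only second differences;
* `norm_onePoint_sub_le_of_ratio_bound` — (C1)+(C2): `‖onePoint n K G − onePoint n K' G‖ ≤ M/|Λ|`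
  from the ratio bound `‖(pertZ(K_s)/pertZ(K)) / (pertZ(K'_s)/pertZ(K')) − 1‖ ≤ M|s|` near `s = 0`.

What remains for `OnePointLipschitz` is that ratio bound with `M = C·|Λ|·‖K − K'‖`, uniformly in `N`
(the second-difference half of [ABKM19] Thm 2.2 along the tuned flow).  All proved; no `sorry`.

## References
* S. Adams, S. Buchholz, R. Kotecký, S. Müller, arXiv:1910.13564, Sec. 2.1, (2.9), Ch. 4 (4.4),
  Theorem 2.2 [AdamsBuchholzKoteckyMuller2019].
-/

noncomputable section

-- `Summit.<Summit>.<Problem>`: single-conjunct summit, the duplicate component is mandated (D-0017).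
set_option linter.dupNamespace false

namespace Summit.HubbardSuperconductivity.HubbardSuperconductivity.Theorems.ComplexGFF

open scoped BigOperators ComplexConjugate Topology
open MeasureTheory Filter
open Literature.MathematicalPhysics.StatisticalMechanics.ComplexGradientGFF4 (Z ev D S w)

variable {n : ℕ}

/-! ### (C2) Second differences control first derivatives -/

/-- **(C2)** If `Φ, Ψ : ℝ → ℂ` are differentiable at `0` with `Φ(0) = Ψ(0) = 1` and
`‖Φ(s)/Ψ(s) − 1‖ ≤ M·|s|` for `s` near `0`, then `‖Φ'(0) − Ψ'(0)‖ ≤ M`. -/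
theorem norm_sub_le_of_norm_div_sub_one_le {Φ Ψ : ℝ → ℂ} {a b : ℂ} {M : ℝ}
    (hΦ : HasDerivAt Φ a 0) (hΨ : HasDerivAt Ψ b 0) (hΦ0 : Φ 0 = 1) (hΨ0 : Ψ 0 = 1)
    (hM : ∀ᶠ s in 𝓝 (0 : ℝ), ‖Φ s / Ψ s - 1‖ ≤ M * |s|) : ‖a - b‖ ≤ M := by
  have h := hΦ.div hΨ (by rw [hΨ0]; exact one_ne_zero)
  have hΘ := h.congr_deriv (show (a * Ψ 0 - Φ 0 * b) / Ψ 0 ^ 2 = a - b by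
    rw [hΦ0, hΨ0]; ring)
  have ht := hΘ.tendsto_slope_zero
  simp only [zero_add, Pi.div_apply, hΦ0, hΨ0, div_one] at ht
  have hn : Tendsto (fun t : ℝ => ‖t⁻¹ • (Φ t / Ψ t - 1)‖) (𝓝[≠] 0) (𝓝 ‖a - b‖) := ht.norm
  refine le_of_tendsto hn ?_
  have hM' : ∀ᶠ s in 𝓝[≠] (0 : ℝ), ‖Φ s / Ψ s - 1‖ ≤ M * |s| := nhdsWithin_le_nhds hM
  filter_upwards [hM', self_mem_nhdsWithin] with t ht1 ht0
  have ht0' : 0 < |t| := abs_pos.mpr ht0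
  rw [norm_smul, norm_inv, Real.norm_eq_abs]
  calc |t|⁻¹ * ‖Φ t / Ψ t - 1‖ ≤ |t|⁻¹ * (M * |t|) :=
        mul_le_mul_of_nonneg_left ht1 (inv_nonneg.mpr ht0'.le)
    _ = M := by field_simp

/-! ### (C1) The derivative of the partition function along `s ↦ K + s·G·(1+K)` -/

/-- continuity of the lattice gradient vector in the field. -/
theorem continuous_gradVec (x : Fin 4 → ZMod n) :
    Continuous (fun φ : (Fin 4 → ZMod n) → ℝ => (fun i => D φ i x : Fin 4 → ℝ)) := by
  refine continuous_pi (fun i => ?_)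
  unfold D; fun_prop

/-- continuity of the perturbed weight `e^{−S_0(φ)} ∏_x (1 + K(∇φ(x)))` for continuous `K`. -/
theorem continuous_weight [NeZero n] {K : (Fin 4 → ℝ) → ℂ} (hKc : Continuous K) :
    Continuous (fun φ : (Fin 4 → ZMod n) → ℝ =>
      Complex.exp (-((S 0 φ : ℝ) : ℂ)) * ∏ x : Fin 4 → ZMod n, (1 + K (fun i => D φ i x))) := by
  have hS : Continuous (fun φ : (Fin 4 → ZMod n) → ℝ => S 0 φ) := by unfold S D; fun_prop
  refine (Complex.continuous_exp.comp (Complex.continuous_ofReal.comp hS).neg).mul ?_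
  exact continuous_finsetProd _ (fun x _ => continuous_const.add (hKc.comp (continuous_gradVec x)))

/-- the algebra of the line: `1 + (K + sG(1+K)) = (1 + K)(1 + sG)` under the site product. -/
theorem prod_one_add_linePert [NeZero n] (K G : (Fin 4 → ℝ) → ℂ) (s : ℂ)
    (φ : (Fin 4 → ZMod n) → ℝ) :
    ∏ x : Fin 4 → ZMod n, (1 + (K (fun i => D φ i x) + s * (G (fun i => D φ i x) * (1 + K (fun i => D φ i x)))))
      = (∏ x : Fin 4 → ZMod n, (1 + K (fun i => D φ i x))) *
          ∏ x : Fin 4 → ZMod n, (1 + s * G (fun i => D φ i x)) := by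
  rw [← Finset.prod_mul_distrib]
  exact Finset.prod_congr rfl (fun x _ => by ring)

/-- **(C1)** For continuous `K` with `‖K(z)‖ ≤ ρ e^{Σ z_i²/4}` and bounded continuous `G`, the map
`s ↦ pertZ n (K + s·G·(1+K))` has derivative `∫ (Σ_x G(∇φ(x))) · e^{−S_0(φ)}∏_x(1+K(∇φ(x))) dφ` at
`s = 0`. -/
theorem hasDerivAt_pertZ_linePert [NeZero n] {K G : (Fin 4 → ℝ) → ℂ} (hKc : Continuous K)
    {ρ : ℝ} (hρ : 0 ≤ ρ) (hKb : ∀ z : Fin 4 → ℝ, ‖K z‖ ≤ ρ * Real.exp ((∑ i : Fin 4, (z i) ^ 2) / 4))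
    (hGc : Continuous G) {M : ℝ} (hGb : ∀ z, ‖G z‖ ≤ M) :
    HasDerivAt (fun s : ℝ => pertZ n (fun z => K z + (s : ℂ) * (G z * (1 + K z))))
      (∫ φ : (Fin 4 → ZMod n) → ℝ, (∑ x : Fin 4 → ZMod n, G (fun i => D φ i x)) *
        (Complex.exp (-((S 0 φ : ℝ) : ℂ)) * ∏ x : Fin 4 → ZMod n, (1 + K (fun i => D φ i x)))) 0 := by
  -- notation
  set W : ((Fin 4 → ZMod n) → ℝ) → ℂ := fun φ =>
    Complex.exp (-((S 0 φ : ℝ) : ℂ)) * ∏ x : Fin 4 → ZMod n, (1 + K (fun i => D φ i x)) with hWdef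
  set Gx : ((Fin 4 → ZMod n) → ℝ) → (Fin 4 → ZMod n) → ℂ := fun φ x => G (fun i => D φ i x) with hGxdef
  have hM0 : 0 ≤ M := (norm_nonneg _).trans (hGb 0)
  have hWint : Integrable W := integrable_pertZ_integrand n hKc hρ hKb
  have hWc : Continuous W := continuous_weight hKc
  have hGxc : ∀ x, Continuous (fun φ : (Fin 4 → ZMod n) → ℝ => Gx φ x) :=
    fun x => hGc.comp (continuous_gradVec x)
  -- the family and its derivative
  set F : ℝ → ((Fin 4 → ZMod n) → ℝ) → ℂ := fun s φ =>
    W φ * ∏ x : Fin 4 → ZMod n, (1 + (s : ℂ) * Gx φ x) with hFdef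
  set F' : ℝ → ((Fin 4 → ZMod n) → ℝ) → ℂ := fun s φ =>
    W φ * ∑ x : Fin 4 → ZMod n,
      (∏ y ∈ (Finset.univ : Finset (Fin 4 → ZMod n)).erase x, (1 + (s : ℂ) * Gx φ y)) • Gx φ x
    with hF'def
  have hfun : (fun s : ℝ => pertZ n (fun z => K z + (s : ℂ) * (G z * (1 + K z))))
      = fun s => ∫ φ, F s φ := by
    funext s
    unfold pertZ
    refine integral_congr_ae (Eventually.of_forall (fun φ => ?_))
    simp only [hFdef, hWdef, hGxdef]
    rw [prod_one_add_linePert, mul_assoc]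
  rw [hfun]
  -- the value of the derivative at `0`
  have hval : (∫ φ : (Fin 4 → ZMod n) → ℝ, (∑ x : Fin 4 → ZMod n, G (fun i => D φ i x)) *
        (Complex.exp (-((S 0 φ : ℝ) : ℂ)) * ∏ x : Fin 4 → ZMod n, (1 + K (fun i => D φ i x))))
      = ∫ φ, F' 0 φ := by
    refine integral_congr_ae (Eventually.of_forall (fun φ => ?_))
    simp only [hF'def, hWdef, hGxdef, Complex.ofReal_zero, zero_mul, add_zero,
      Finset.prod_const_one, one_smul]
    ring
  rw [hval]
  -- hypotheses of the dominated differentiation theorem on the ball `|s| < 1`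
  have hball : Metric.ball (0 : ℝ) 1 ∈ 𝓝 (0 : ℝ) := Metric.ball_mem_nhds 0 one_pos
  have hprodc : ∀ s : ℝ, Continuous (fun φ : (Fin 4 → ZMod n) → ℝ =>
      ∏ x : Fin 4 → ZMod n, (1 + (s : ℂ) * Gx φ x)) := fun s =>
    continuous_finsetProd _ (fun x _ => continuous_const.add (continuous_const.mul (hGxc x)))
  have hF_meas : ∀ s : ℝ, AEStronglyMeasurable (F s) volume := fun s =>
    (hWc.mul (hprodc s)).aestronglyMeasurable
  have hF_int : Integrable (F 0) := by
    refine (hWint.congr (Eventually.of_forall (fun φ => ?_)))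
    simp [hFdef]
  have hsumc : ∀ s : ℝ, Continuous (fun φ : (Fin 4 → ZMod n) → ℝ => ∑ x : Fin 4 → ZMod n,
      (∏ y ∈ (Finset.univ : Finset (Fin 4 → ZMod n)).erase x, (1 + (s : ℂ) * Gx φ y)) • Gx φ x) :=
    fun s => continuous_finsetSum _ (fun x _ =>
      (continuous_finsetProd _ (fun y _ => continuous_const.add (continuous_const.mul (hGxc y)))).smul
        (hGxc x))
  have hF'_meas : AEStronglyMeasurable (F' 0) volume := (hWc.mul (hsumc 0)).aestronglyMeasurable
  -- the dominating function
  set Λc : ℕ := Fintype.card (Fin 4 → ZMod n) with hΛc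
  have h_bound : ∀ᵐ φ : (Fin 4 → ZMod n) → ℝ ∂volume, ∀ s ∈ Metric.ball (0 : ℝ) 1,
      ‖F' s φ‖ ≤ (Λc * ((1 + M) ^ Λc * M)) * ‖W φ‖ := by
    refine Eventually.of_forall (fun φ s hs => ?_)
    have hs1 : |s| ≤ 1 := by
      have := Metric.mem_ball.mp hs
      rw [dist_zero_right, Real.norm_eq_abs] at this
      exact this.le
    have hfac : ∀ y, ‖1 + (s : ℂ) * Gx φ y‖ ≤ 1 + M := fun y => by
      calc ‖1 + (s : ℂ) * Gx φ y‖ ≤ ‖(1 : ℂ)‖ + ‖(s : ℂ) * Gx φ y‖ := norm_add_le _ _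
        _ = 1 + |s| * ‖Gx φ y‖ := by rw [norm_one, norm_mul, Complex.norm_real, Real.norm_eq_abs]
        _ ≤ 1 + 1 * M := by
            have h := mul_le_mul hs1 (hGb (fun i => D φ i y)) (norm_nonneg _) zero_le_one
            linarith
        _ = 1 + M := by ring
    have hterm : ∀ x, ‖(∏ y ∈ (Finset.univ : Finset (Fin 4 → ZMod n)).erase x,
        (1 + (s : ℂ) * Gx φ y)) • Gx φ x‖ ≤ (1 + M) ^ Λc * M := by
      intro x
      rw [norm_smul]
      refine mul_le_mul ?_ (hGb _) (norm_nonneg _) (by positivity)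
      calc ‖∏ y ∈ (Finset.univ : Finset (Fin 4 → ZMod n)).erase x, (1 + (s : ℂ) * Gx φ y)‖
          ≤ ∏ y ∈ (Finset.univ : Finset (Fin 4 → ZMod n)).erase x, ‖1 + (s : ℂ) * Gx φ y‖ :=
            Finset.norm_prod_le _ _
        _ ≤ ∏ _y ∈ (Finset.univ : Finset (Fin 4 → ZMod n)).erase x, (1 + M) :=
            Finset.prod_le_prod (fun y _ => norm_nonneg _) (fun y _ => hfac y)
        _ = (1 + M) ^ ((Finset.univ : Finset (Fin 4 → ZMod n)).erase x).card := Finset.prod_const _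
        _ ≤ (1 + M) ^ Λc :=
            pow_le_pow_right₀ (by linarith) (by rw [hΛc, ← Finset.card_univ]; exact Finset.card_erase_le)
    calc ‖F' s φ‖ = ‖W φ‖ * ‖∑ x : Fin 4 → ZMod n,
          (∏ y ∈ (Finset.univ : Finset (Fin 4 → ZMod n)).erase x, (1 + (s : ℂ) * Gx φ y)) • Gx φ x‖ := by
          rw [hF'def, norm_mul]
      _ ≤ ‖W φ‖ * ∑ x : Fin 4 → ZMod n, ‖(∏ y ∈ (Finset.univ : Finset (Fin 4 → ZMod n)).erase x,
          (1 + (s : ℂ) * Gx φ y)) • Gx φ x‖ :=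
          mul_le_mul_of_nonneg_left (norm_sum_le _ _) (norm_nonneg _)
      _ ≤ ‖W φ‖ * ∑ _x : Fin 4 → ZMod n, (1 + M) ^ Λc * M :=
          mul_le_mul_of_nonneg_left (Finset.sum_le_sum (fun x _ => hterm x)) (norm_nonneg _)
      _ = (Λc * ((1 + M) ^ Λc * M)) * ‖W φ‖ := by
          rw [Finset.sum_const, Finset.card_univ, nsmul_eq_mul, hΛc]; ring
  have hb_int : Integrable (fun φ : (Fin 4 → ZMod n) → ℝ => (Λc * ((1 + M) ^ Λc * M)) * ‖W φ‖) :=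
    hWint.norm.const_mul _
  -- pointwise differentiability in `s`
  have h_diff : ∀ᵐ φ : (Fin 4 → ZMod n) → ℝ ∂volume, ∀ s ∈ Metric.ball (0 : ℝ) 1,
      HasDerivAt (F · φ) (F' s φ) s := by
    refine Eventually.of_forall (fun φ s _ => ?_)
    have hlin : ∀ x ∈ (Finset.univ : Finset (Fin 4 → ZMod n)),
        HasDerivAt (fun t : ℝ => 1 + (t : ℂ) * Gx φ x) (Gx φ x) s := by
      intro x _
      have h1 : HasDerivAt (fun t : ℝ => (t : ℂ)) 1 s := (hasDerivAt_id s).ofReal_comp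
      have h2 := (h1.mul_const (Gx φ x)).const_add 1
      simpa using h2
    have hP := HasDerivAt.fun_finsetProd hlin
    exact hP.const_mul (W φ)
  exact (hasDerivAt_integral_of_dominated_loc_of_deriv_le hball
    (Eventually.of_forall hF_meas) hF_int hF'_meas h_bound hb_int h_diff).2

/-- **(C1), normalised**: if moreover `pertZ n K ≠ 0`, the ratio `s ↦ pertZ n (K + sG(1+K)) / pertZ n K`
has derivative `|Λ| · onePoint n K G` at `s = 0`. -/
theorem hasDerivAt_pertZ_linePert_div [NeZero n] {K G : (Fin 4 → ℝ) → ℂ} (hKc : Continuous K)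
    {ρ : ℝ} (hρ : 0 ≤ ρ) (hKb : ∀ z : Fin 4 → ℝ, ‖K z‖ ≤ ρ * Real.exp ((∑ i : Fin 4, (z i) ^ 2) / 4))
    (hGc : Continuous G) {M : ℝ} (hGb : ∀ z, ‖G z‖ ≤ M) (hZ : pertZ n K ≠ 0) :
    HasDerivAt (fun s : ℝ => pertZ n (fun z => K z + (s : ℂ) * (G z * (1 + K z))) / pertZ n K)
      ((Fintype.card (Fin 4 → ZMod n) : ℂ) * onePoint n K G) 0 := by
  have h := (hasDerivAt_pertZ_linePert (n := n) hKc hρ hKb hGc hGb).div_const (pertZ n K)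
  have hcard : (Fintype.card (Fin 4 → ZMod n) : ℂ) ≠ 0 := Nat.cast_ne_zero.mpr Fintype.card_ne_zero
  refine h.congr_deriv ?_
  unfold onePoint
  field_simp

/-! ### (C1) + (C2): the one-point functions differ by at most the second-difference constant -/

/-- **`‖onePoint n K G − onePoint n K' G‖ ≤ M/|Λ|` from the ratio bound.**  If `K, K'` are continuous of
Gaussian growth with `pertZ n K ≠ 0 ≠ pertZ n K'`, `G` is bounded continuous, and near `s = 0`
`‖(pertZ(K + sG(1+K))/pertZ(K)) / (pertZ(K' + sG(1+K'))/pertZ(K')) − 1‖ ≤ M·|s|`, then the one-point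
functions at `K` and `K'` differ by at most `M/|Λ|`. -/
theorem norm_onePoint_sub_le_of_ratio_bound [NeZero n] {K K' G : (Fin 4 → ℝ) → ℂ}
    (hKc : Continuous K) (hK'c : Continuous K') {ρ : ℝ} (hρ : 0 ≤ ρ)
    (hKb : ∀ z : Fin 4 → ℝ, ‖K z‖ ≤ ρ * Real.exp ((∑ i : Fin 4, (z i) ^ 2) / 4))
    (hK'b : ∀ z : Fin 4 → ℝ, ‖K' z‖ ≤ ρ * Real.exp ((∑ i : Fin 4, (z i) ^ 2) / 4))
    (hGc : Continuous G) {B : ℝ} (hGb : ∀ z, ‖G z‖ ≤ B) (hZ : pertZ n K ≠ 0) (hZ' : pertZ n K' ≠ 0)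
    {M : ℝ}
    (hM : ∀ᶠ s : ℝ in 𝓝 0,
      ‖(pertZ n (fun z => K z + ((s : ℝ) : ℂ) * (G z * (1 + K z))) / pertZ n K) /
          (pertZ n (fun z => K' z + ((s : ℝ) : ℂ) * (G z * (1 + K' z))) / pertZ n K') - 1‖
        ≤ M * |s|) :
    ‖onePoint n K G - onePoint n K' G‖ ≤ M / Fintype.card (Fin 4 → ZMod n) := by
  have hΦ := hasDerivAt_pertZ_linePert_div (n := n) hKc hρ hKb hGc hGb hZ
  have hΨ := hasDerivAt_pertZ_linePert_div (n := n) hK'c hρ hK'b hGc hGb hZ'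
  have hΦ0 : pertZ n (fun z => K z + ((0 : ℝ) : ℂ) * (G z * (1 + K z))) / pertZ n K = 1 := by
    simp only [Complex.ofReal_zero, zero_mul, add_zero]
    exact div_self hZ
  have hΨ0 : pertZ n (fun z => K' z + ((0 : ℝ) : ℂ) * (G z * (1 + K' z))) / pertZ n K' = 1 := by
    simp only [Complex.ofReal_zero, zero_mul, add_zero]
    exact div_self hZ'
  have h := norm_sub_le_of_norm_div_sub_one_le hΦ hΨ hΦ0 hΨ0 hM
  have hcard : (0 : ℝ) < Fintype.card (Fin 4 → ZMod n) := Nat.cast_pos.mpr Fintype.card_pos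
  rw [← mul_sub, norm_mul, Complex.norm_natCast] at h
  rw [le_div_iff₀ hcard, mul_comm]
  exact h

end Summit.HubbardSuperconductivity.HubbardSuperconductivity.Theorems.ComplexGFF

end
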